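import Literature.NumberTheory.LFunctions.GaussianLinePhase
import Literature.NumberTheory.LFunctions.KorobovUBoundAbstract
import Literature.NumberTheory.LFunctions.GaussianLineGoodIndex
import HarnessLib

/-!
# Vinogradov's estimate for the lattice sums `∑ λ^m(z) N(z)^{-it}` along a line `Im z = b` of `ℤ[i]`

Topic `Literature/NumberTheory/LFunctions`.  Everything in this file is PROVED; no definitions, no named facts.
This is the `ℚ(i)`-analogue of Theorem 6.2 of A. Ivić, *The Riemann Zeta-Function* (Wiley 1985) — Vinogradov's
estimate `∑_{N<n≤N'} n^{it} ≪ N exp(−c log³N/log²t)` — for the sums of `Φ(z) = λ^m(z) N(z)^{-it}`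
(`λ^m(z) = (z/|z|)^{4m}`, `GaussianInt.angularChar`) over the lattice points of a segment of the line `Im z = b`:

* `norm_lineSum_le` — for `b ≠ 0`, `−|b| ≤ A₁`, `A₂ ≤ |b|`, `ℓ = log|b|` large, `w = 4m − 2ti`, `|w| = e^{Yℓ}` with
  `Y ≥ 0.12`:  `‖∑_{A₁ ≤ a ≤ A₂} Φ(a + bi)‖ ≤ 11 |b| exp(−ℓ/(10¹² max(1, Y²)))`.

This is M. D. Coleman's Theorem 1 (Mathematika 37 (1990)) for `K = ℚ(i)`, conductor `1`, restricted to a line, and is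
summed over the lines in `GaussianLatticeExpSum.lean`.  Proof (Korobov's method ON THE LINE, the route of the
tree's `VinogradovZetaSum.*` files for `n^{-it}`): Vinogradov's shift `a ↦ a + xy`, `x, y ≤ a₀ = ⌊|b|^{0.48}⌋`, and the
Taylor expansion of `Im(w log(1 + xy/z))` (`GaussLine.norm_lineSum_le_shift`) reduce the sum to the bilinear sums
`U(a) = ∑_{x,y ≤ a₀} e(∑_{j<r} α_j(a)(xy)^{j+1})`, `α_j(a) = (−1)^j Im(w z_a^{-(j+1)})/(2π(j+1))`, `z_a = a + bi`,
`r = ⌊25Y⌋ + 2`; Korobov's bound with a prescribed set of good indices (`KorobovU.norm_U_le_of_good`, `k = 11r²`,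
`ρ = 10r` iterations of the mean value theorem) needs, for the indices `p = j+1 ∈ [⌈(Y+0.06)/0.52⌉, ⌊20Y⌋]`, the
two-sided size `(3/10)|w||z_a|^{-p} ≤ 2πp|α_j(a)| ≤ |w||z_a|^{-p}`, which holds for at least every other `p`
(`GaussLine.im_sq_or_im_div_sq`: `|Re z_a| ≤ |Im z_a|`), each such index saving `0.15Yℓ`
(`GaussLine.log_geomSum_le_of_coeff_bounds`); the losses `2hδ log a₀ + 660r³ log(32r) + 2r log(3k)` are smaller in the
range `Y² ≤ 10^{-12} ℓ`, and outside it the claim is weaker than the trivial bound.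

## References

* A. Ivić, *The Riemann Zeta-Function*, John Wiley & Sons 1985 (Dover 2003), §6.3, Theorem 6.2 and its proof.
  [cite: Ivic1985, Theorem 6.2]
* M. D. Coleman, *A zero-free region for the Hecke L-functions*, Mathematika 37 (1990), 287–304, Theorem 1.
  [cite: ColemanMathematika1990, Theorem 1]
-/

noncomputable section

open Complex Finset Real

namespace Literature.NumberTheory.LFunctions

namespace GaussLine

open VdC (e)
open GaussianInt (angularChar)
open Sieve.Vinogradov (geomBound)
open VinogradovZetaSum (one_sub_inv_pow_mul_le exp_neg_one_le_half)

/-! ### Elementary numerics -/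

/-- `e^{-10} ≤ 1/20000` (`e ≥ 2.7`, `2.7^{10} ≥ 20589`). [folklore] -/
theorem exp_neg_ten_le : Real.exp (-(10 : ℝ)) ≤ 1 / 20000 := by
  have h := Real.exp_one_gt_d9
  have h10 : (20000 : ℝ) ≤ Real.exp 10 := by
    have : Real.exp 10 = (Real.exp 1) ^ 10 := by rw [← Real.exp_nat_mul]; norm_num
    rw [this]
    have h2 : (2.7182818283 : ℝ) ^ 10 ≤ (Real.exp 1) ^ 10 := pow_le_pow_left₀ (by norm_num) h.le 10
    exact le_trans (by norm_num) h2
  rw [Real.exp_neg, one_div]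
  exact inv_anti₀ (by norm_num) h10

/-- Floor/ceiling facts for the candidate window: with `p₁ = ⌈(Y + 0.06)/0.52⌉`, `p₂ = ⌊20Y⌋`, `Y ≥ 0.12`:
`1 ≤ p₁`, `p₁ ≤ (Y+0.06)/0.52 + 1`, `20Y − 1 ≤ p₂ ≤ 20Y`, `p₁ + 1 ≤ p₂`. [folklore] -/
theorem window_facts {Y : ℝ} (hY : 0.12 ≤ Y) :
    1 ≤ ⌈(Y + 0.06) / 0.52⌉₊ ∧ (⌈(Y + 0.06) / 0.52⌉₊ : ℝ) < (Y + 0.06) / 0.52 + 1 ∧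
      (Y + 0.06) / 0.52 ≤ (⌈(Y + 0.06) / 0.52⌉₊ : ℝ) ∧
      20 * Y - 1 < (⌊20 * Y⌋₊ : ℝ) ∧ (⌊20 * Y⌋₊ : ℝ) ≤ 20 * Y ∧ ⌈(Y + 0.06) / 0.52⌉₊ + 1 ≤ ⌊20 * Y⌋₊ := by
  have hY0 : 0 < Y := by linarith
  have hq0 : 0 < (Y + 0.06) / 0.52 := by positivity
  have h1 : 1 ≤ ⌈(Y + 0.06) / 0.52⌉₊ := Nat.one_le_iff_ne_zero.mpr (by
    rw [Ne, Nat.ceil_eq_zero, not_le]; exact hq0)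
  have h2 : (⌈(Y + 0.06) / 0.52⌉₊ : ℝ) < (Y + 0.06) / 0.52 + 1 := Nat.ceil_lt_add_one hq0.le
  have h3 : (Y + 0.06) / 0.52 ≤ (⌈(Y + 0.06) / 0.52⌉₊ : ℝ) := Nat.le_ceil _
  have h4 : 20 * Y - 1 < (⌊20 * Y⌋₊ : ℝ) := Nat.sub_one_lt_floor _
  have h5 : (⌊20 * Y⌋₊ : ℝ) ≤ 20 * Y := Nat.floor_le (by positivity)
  refine ⟨h1, h2, h3, h4, h5, ?_⟩
  have hlt : (⌈(Y + 0.06) / 0.52⌉₊ : ℝ) + 1 < (⌊20 * Y⌋₊ : ℝ) + 1 := by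
    have : (Y + 0.06) / 0.52 + 1 ≤ 20 * Y - 1 := by
      rw [div_add_one (by norm_num), div_le_iff₀ (by norm_num)]; nlinarith
    linarith
  have : (⌈(Y + 0.06) / 0.52⌉₊ : ℝ) < ⌊20 * Y⌋₊ := by linarith
  exact_mod_cast this

/-! ### The estimate on a line -/

set_option maxHeartbeats 6000000 in
/-- **Vinogradov's estimate for `∑ λ^m(z) N(z)^{-it}` along a line of `ℤ[i]`** (the `ℚ(i)`-analogue of Ivić's
Theorem 6.2 on the line `Im z = b`).  Let `b ≠ 0`, `−|b| ≤ A₁`, `A₂ ≤ |b|`, `ℓ = log|b|` with `ℓ ≥ 10¹⁴` and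
`log ℓ ≤ 10⁻⁵ ℓ`, `w = 4m − 2ti` with `log|w| = Yℓ`, `Y ≥ 0.12`.  Then
`‖∑_{A₁ ≤ a ≤ A₂} λ^m(a + bi) N(a + bi)^{-it}‖ ≤ 11 |b| exp(−ℓ/(10¹² max(1, Y²)))`.
[cite: Ivic1985, Theorem 6.2] [cite: ColemanMathematika1990, Theorem 1] -/
theorem norm_lineSum_le {b : ℤ} (hb : b ≠ 0) {A₁ A₂ : ℤ} (hA₁ : -|b| ≤ A₁) (hA₂ : A₂ ≤ |b|) (m : ℕ) (t : ℝ)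
    {ℓ Y : ℝ} (hℓ : Real.log |(b : ℝ)| = ℓ) (hYℓ : Y * ℓ = Real.log ‖(4 * (m : ℂ) - 2 * t * I)‖)
    (hY : 0.12 ≤ Y) (c1 : 1e14 ≤ ℓ) (c2 : Real.log ℓ ≤ 1e-5 * ℓ) :
    ‖∑ a ∈ Icc A₁ A₂, angularChar m ⟨a, b⟩ * (((((⟨a, b⟩ : GaussianInt).norm : ℝ)) : ℂ) ^ (-(t * I)))‖ ≤
      11 * |(b : ℝ)| * Real.exp (-(ℓ / (1e12 * max 1 (Y ^ 2)))) := by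
  classical
  -- ### notation and basic facts
  set w : ℂ := 4 * (m : ℂ) - 2 * t * I with hw
  set τ : ℝ := ‖w‖ with hτdef
  set B : ℝ := |(b : ℝ)| with hB
  have hB0 : 0 < B := by rw [hB]; exact abs_pos.mpr (by exact_mod_cast hb)
  have hB1 : 1 ≤ B := by rw [hB, ← Int.cast_abs]; exact_mod_cast Int.one_le_abs hb
  have hℓ0 : 0 < ℓ := by linarith
  have hBexp : B = Real.exp ℓ := by rw [← hℓ, Real.exp_log hB0]
  have hY0 : 0 < Y := by linarith
  have hYℓ0 : 0 < Y * ℓ := by positivity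
  have hτ0 : 0 < τ := by
    by_contra h
    have h0 : τ = 0 := le_antisymm (not_lt.mp h) (norm_nonneg _)
    rw [h0, Real.log_zero] at hYℓ
    linarith
  have hτ : Real.log τ = Y * ℓ := hYℓ.symm
  have hτexp : τ = Real.exp (Y * ℓ) := by rw [← hτ, Real.exp_log hτ0]
  set zOf : ℤ → GaussianInt := fun a ↦ ⟨a, b⟩ with hzOf
  set F : ℤ → ℂ := fun a ↦ angularChar m (zOf a) * ((((zOf a).norm : ℝ)) : ℂ) ^ (-(t * I)) with hF
  have hz0 : ∀ a, zOf a ≠ 0 := fun a h0 ↦ hb (by have := congrArg Zsqrtd.im h0; simpa [hzOf] using this)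
  have hF1 : ∀ a, ‖F a‖ = 1 := fun a ↦ norm_phase_eq_one m t (hz0 a)
  -- ### the trivial bound `‖S‖ ≤ 3B`
  have hcardI : ((Icc A₁ A₂).card : ℝ) ≤ 3 * B := by
    rw [Int.card_Icc]
    rcases le_or_gt (A₂ + 1 - A₁) 0 with h | h
    · rw [Int.toNat_of_nonpos h]; simp; linarith
    · have : ((A₂ + 1 - A₁).toNat : ℝ) = ((A₂ + 1 - A₁ : ℤ) : ℝ) := by exact_mod_cast Int.toNat_of_nonneg h.le
      rw [this]; push_cast
      have h1 : (A₂ : ℝ) ≤ |(b : ℝ)| := by rw [← Int.cast_abs]; exact_mod_cast hA₂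
      have h2 : -|(b : ℝ)| ≤ (A₁ : ℝ) := by rw [← Int.cast_abs]; exact_mod_cast hA₁
      rw [← hB] at h1 h2
      linarith
  have htriv : ‖∑ a ∈ Icc A₁ A₂, F a‖ ≤ 3 * B := by
    calc ‖∑ a ∈ Icc A₁ A₂, F a‖ ≤ ∑ a ∈ Icc A₁ A₂, ‖F a‖ := norm_sum_le _ _
      _ = (Icc A₁ A₂).card := by simp [hF1]
      _ ≤ 3 * B := hcardI
  -- ### the trivial regime `Y² > 10⁻¹² ℓ`
  set M : ℝ := max 1 (Y ^ 2) with hMdef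
  have hM1 : 1 ≤ M := le_max_left _ _
  have hM0 : 0 < M := by linarith
  have hMY : Y ^ 2 ≤ M := le_max_right _ _
  by_cases hrange : ℓ < 1e12 * Y ^ 2
  · have hexp : Real.exp (-1) ≤ Real.exp (-(ℓ / (1e12 * M))) := by
      rw [Real.exp_le_exp, neg_le_neg_iff, div_le_one (by positivity)]
      calc ℓ ≤ 1e12 * Y ^ 2 := hrange.le
        _ ≤ 1e12 * M := by gcongr
    have he3 : (1 : ℝ) / 3 ≤ Real.exp (-1) := by
      rw [Real.exp_neg, one_div, inv_le_inv₀ (by norm_num) (Real.exp_pos 1)]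
      have := Real.exp_one_lt_d9; linarith
    calc ‖∑ a ∈ Icc A₁ A₂, F a‖ ≤ 3 * B := htriv
      _ ≤ 11 * B * (1 / 3) := by linarith
      _ ≤ 11 * B * Real.exp (-(ℓ / (1e12 * M))) := by gcongr; exact he3.trans hexp
  rw [not_lt] at hrange
  have hYsq : Y ^ 2 ≤ 1e-12 * ℓ := by linarith
  -- ### the parameters
  set a₀ : ℕ := ⌊Real.exp (0.48 * ℓ)⌋₊ with ha₀
  set r : ℕ := ⌊25 * Y⌋₊ + 2 with hrdef
  set ρ : ℕ := 10 * r with hρdef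
  set k : ℕ := 11 * r ^ 2 with hkdef
  -- `a₀`
  have hx2 : 2 ≤ Real.exp (0.48 * ℓ) := by have := Real.add_one_le_exp (0.48 * ℓ); linarith
  have hax : (a₀ : ℝ) ≤ Real.exp (0.48 * ℓ) := Nat.floor_le (by positivity)
  have ha_half : Real.exp (0.48 * ℓ) / 2 ≤ a₀ := by
    have : Real.exp (0.48 * ℓ) - 1 ≤ a₀ := (Nat.sub_one_lt_floor _).le
    linarith
  have ha₀1r : (1 : ℝ) ≤ a₀ := by linarith
  have ha₀1 : 1 ≤ a₀ := by exact_mod_cast ha₀1r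
  have ha₀0 : (0 : ℝ) < a₀ := by linarith
  have hloga₀ : Real.log a₀ ≤ 0.48 * ℓ := by
    rw [← Real.log_exp (0.48 * ℓ)]; exact Real.log_le_log ha₀0 hax
  have hlog2 : Real.log 2 ≤ 0.7 := by have := Real.log_two_lt_d9; linarith
  have ha2B : 2 * (a₀ : ℝ) ^ 2 ≤ B := by
    have h1 : (a₀ : ℝ) ^ 2 ≤ Real.exp (0.96 * ℓ) := by
      calc (a₀ : ℝ) ^ 2 ≤ (Real.exp (0.48 * ℓ)) ^ 2 := pow_le_pow_left₀ ha₀0.le hax 2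
        _ = Real.exp (0.96 * ℓ) := by rw [← Real.exp_nat_mul]; ring_nf
    have h2 : 2 * Real.exp (0.96 * ℓ) ≤ Real.exp ℓ := by
      have : (2 : ℝ) ≤ Real.exp (0.04 * ℓ) := by
        calc (2 : ℝ) = Real.exp (Real.log 2) := (Real.exp_log two_pos).symm
          _ ≤ Real.exp (0.04 * ℓ) := Real.exp_le_exp.mpr (by linarith)
      calc 2 * Real.exp (0.96 * ℓ) ≤ Real.exp (0.04 * ℓ) * Real.exp (0.96 * ℓ) := by gcongr
        _ = Real.exp ℓ := by rw [← Real.exp_add]; ring_nf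
    rw [hBexp]; linarith
  have ha2B' : (a₀ : ℝ) ^ 2 / B ≤ Real.exp (-(0.04 * ℓ)) := by
    rw [div_le_iff₀ hB0, hBexp, ← Real.exp_add]
    calc (a₀ : ℝ) ^ 2 ≤ (Real.exp (0.48 * ℓ)) ^ 2 := pow_le_pow_left₀ ha₀0.le hax 2
      _ = Real.exp (-(0.04 * ℓ) + ℓ) := by rw [← Real.exp_nat_mul]; ring_nf
  -- `r`
  have hr_gt : 25 * Y + 1 < r := by
    rw [hrdef]; push_cast; linarith [Nat.lt_floor_add_one (25 * Y)]
  have hr_le : (r : ℝ) ≤ 25 * Y + 2 := by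
    rw [hrdef]; push_cast; linarith [Nat.floor_le (show 0 ≤ 25 * Y by positivity)]
  have hr2 : 2 ≤ r := by rw [hrdef]; omega
  have hr1 : 1 ≤ r := by omega
  have hr0 : (0 : ℝ) < r := by exact_mod_cast (by omega : 0 < r)
  have hρ1 : 1 ≤ ρ := by rw [hρdef]; omega
  have hk_eq : r ^ 2 + r * ρ ≤ k := by rw [hkdef, hρdef]; nlinarith
  have hk1 : 1 ≤ k := by rw [hkdef]; nlinarith
  have hkr : (k : ℝ) = 11 * (r : ℝ) ^ 2 := by rw [hkdef]; push_cast; ring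
  have hρr : (ρ : ℝ) = 10 * r := by rw [hρdef]; push_cast; ring
  -- `r ≤ 27 max(Y, 1)` etc.
  have hr27 : (r : ℝ) ≤ 27 * max Y 1 := by
    have h1 : Y ≤ max Y 1 := le_max_left _ _
    have h2 : (1 : ℝ) ≤ max Y 1 := le_max_right _ _
    linarith
  have hrℓ : (r : ℝ) ^ 2 ≤ ℓ := by
    have h1 : (r : ℝ) ^ 2 ≤ (25 * Y + 2) ^ 2 := pow_le_pow_left₀ hr0.le hr_le 2
    nlinarith only [h1, sq_nonneg (Y - 1), hYsq, c1, hY0]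
  -- `log(3k) ≤ 2 log ℓ ≤ ℓ/100`
  have h3k : Real.log (3 * k) ≤ ℓ / 100 := by
    have h1 : 3 * (k : ℝ) ≤ ℓ ^ 2 := by
      rw [hkr]
      have : 33 * (r : ℝ) ^ 2 ≤ 33 * ℓ := by linarith only [hrℓ]
      have h' : 33 * ℓ ≤ ℓ ^ 2 := by nlinarith only [c1]
      linarith only [this, h']
    have h2 : Real.log (3 * k) ≤ Real.log (ℓ ^ 2) := Real.log_le_log (by positivity) h1
    rw [Real.log_pow] at h2
    push_cast at h2
    linarith only [h2, c2, hℓ0]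
  -- ### the shift (`GaussLine.norm_lineSum_le_shift`)
  have hshift := norm_lineSum_le_shift hb hA₁ hA₂ m t ha₀1 (by rw [← hB]; exact ha2B) r
  rw [← hw] at hshift
  -- the two error terms are `≤ 8 B e^{-0.04ℓ}`
  have herr1 : 6 * |(b : ℝ)| * ‖w‖ * ((a₀ : ℝ) ^ 2 / |(b : ℝ)|) ^ (r + 1) ≤ 6 * B * Real.exp (-(0.04 * ℓ)) := by
    rw [← hB, ← hτdef]
    have h1 : ((a₀ : ℝ) ^ 2 / B) ^ (r + 1) ≤ Real.exp (-(0.04 * ℓ)) ^ (r + 1) :=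
      pow_le_pow_left₀ (by positivity) ha2B' _
    have h2 : τ * Real.exp (-(0.04 * ℓ)) ^ (r + 1) ≤ Real.exp (-(0.04 * ℓ)) := by
      rw [hτexp, ← Real.exp_nat_mul, ← Real.exp_add, Real.exp_le_exp]
      push_cast
      have H := mul_le_mul_of_nonneg_right hr_gt.le hℓ0.le
      nlinarith only [H, hℓ0, hY0]
    calc 6 * B * τ * ((a₀ : ℝ) ^ 2 / B) ^ (r + 1) ≤ 6 * B * (τ * Real.exp (-(0.04 * ℓ)) ^ (r + 1)) := by
          rw [mul_assoc (6 * B)]; gcongr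
      _ ≤ 6 * B * Real.exp (-(0.04 * ℓ)) := by gcongr
  have herr2 : 2 * (a₀ : ℝ) ^ 2 ≤ 2 * B * Real.exp (-(0.04 * ℓ)) := by
    calc 2 * (a₀ : ℝ) ^ 2 = 2 * B * ((a₀ : ℝ) ^ 2 / B) := by field_simp
      _ ≤ 2 * B * Real.exp (-(0.04 * ℓ)) := by gcongr
  -- ### the bilinear sums: `‖U(a)‖ ≤ a₀² exp(−ℓ/(10¹² M))` for every `a` in the range
  -- the window of candidate indices
  obtain ⟨hp₁1, hp₁lt, hp₁ge, hp₂gt, hp₂le, hp₁₂⟩ := window_facts hY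
  set p₁ : ℕ := ⌈(Y + 0.06) / 0.52⌉₊ with hp₁def
  set p₂ : ℕ := ⌊20 * Y⌋₊ with hp₂def
  have hp₂r : p₂ < r := by
    have : (p₂ : ℝ) < r := by linarith
    exact_mod_cast this
  set n : ℕ := p₂ + 1 - p₁ with hndef
  have hn2 : 2 ≤ n := by rw [hndef]; omega
  have hnreal : (n : ℝ) = p₂ + 1 - p₁ := by
    rw [hndef]; have : p₁ ≤ p₂ + 1 := by omega
    push_cast [Nat.cast_sub this]; ring
  have hn_ge : 18.07 * Y - 1.12 ≤ n := by
    rw [hnreal]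
    have : (p₁ : ℝ) ≤ (Y + 0.06) / 0.52 + 1 := hp₁lt.le
    have h' : (Y + 0.06) / 0.52 ≤ 1.93 * Y + 0.12 := by
      rw [div_le_iff₀ (by norm_num)]; linarith only [hY0]
    linarith only [this, h', hp₂gt]
  -- the bound for one `a`
  have hU : ∀ a ∈ Icc A₁ A₂,
      ‖∑ x ∈ Icc (1 : ℤ) a₀, ∑ y ∈ Icc (1 : ℤ) a₀,
        e (∑ j : Fin r, ((-1) ^ (j.val) * ((w * ((((⟨a, b⟩ : GaussianInt) : ℂ))⁻¹) ^ (j.val + 1)).im) /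
          (2 * π * (j.val + 1))) * ((x : ℝ) ^ (j.val + 1) * (y : ℝ) ^ (j.val + 1)))‖ ≤
        (a₀ : ℝ) ^ 2 * Real.exp (-(ℓ / (1e12 * M))) := by
    intro a ha
    rw [mem_Icc] at ha
    set z : GaussianInt := ⟨a, b⟩ with hzdef
    have hzC : (z : ℂ) ≠ 0 := coe_ne_zero_of_im (by rw [hzdef]; exact hb)
    have hzre : |(z : ℂ).re| ≤ |(z : ℂ).im| := by
      rw [hzdef, GaussianInt.toComplex_def']
      simp only [add_re, intCast_re, mul_re, intCast_im, I_re, mul_zero, I_im, mul_one, sub_self, add_zero,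
        add_im, mul_im, zero_add]
      rw [← Int.cast_abs, ← Int.cast_abs]
      have : |a| ≤ |b| := abs_le.mpr ⟨by linarith, by linarith⟩
      exact_mod_cast this
    -- `B ≤ ‖z‖ ≤ 2B`
    have hzB : B ≤ ‖(z : ℂ)‖ := by rw [hB]; exact abs_le_norm_mk a b
    have hz2B : ‖(z : ℂ)‖ ≤ 2 * B := by
      refine (Complex.norm_le_abs_re_add_abs_im _).trans ?_
      rw [hzdef, GaussianInt.toComplex_def']
      simp only [add_re, intCast_re, mul_re, intCast_im, I_re, mul_zero, I_im, mul_one, sub_self, add_zero,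
        add_im, mul_im, zero_add]
      rw [← Int.cast_abs, ← Int.cast_abs, hB, ← Int.cast_abs]
      have : |a| ≤ |b| := abs_le.mpr ⟨by linarith, by linarith⟩
      have : ((|a| : ℤ) : ℝ) ≤ ((|b| : ℤ) : ℝ) := by exact_mod_cast this
      linarith
    have hzpos : 0 < ‖(z : ℂ)‖ := lt_of_lt_of_le hB0 hzB
    -- the coefficient vector and the vectors `u_p = w z^{-p}`
    set α : Fin r → ℝ := fun j ↦ (-1) ^ (j.val) * ((w * (((z : ℂ))⁻¹) ^ (j.val + 1)).im) / (2 * π * (j.val + 1))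
      with hαdef
    set u : ℕ → ℂ := fun p ↦ w * (((z : ℂ))⁻¹) ^ p with hudef
    have hu_succ : ∀ p, u p / (z : ℂ) = u (p + 1) := fun p ↦ by
      rw [hudef]; dsimp only; rw [pow_succ, div_eq_mul_inv, mul_assoc]
    have hu_norm : ∀ p, ‖u p‖ = τ / ‖(z : ℂ)‖ ^ p := fun p ↦ by
      rw [hudef]; dsimp only; rw [norm_mul, norm_pow, norm_inv, hτdef, inv_pow, div_eq_mul_inv]
    have hα_abs : ∀ j : Fin r, |α j| = |(u (j.val + 1)).im| / (2 * π * (j.val + 1)) := by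
      intro j
      rw [hαdef]; dsimp only
      rw [abs_div, abs_mul, abs_pow, abs_neg, abs_one, one_pow, one_mul,
        abs_of_pos (by positivity : (0 : ℝ) < 2 * π * (j.val + 1))]
    -- the good set (in `ℕ`) and its transport to `Fin r`
    set P : ℕ → Prop := fun p ↦ 9 / 100 * ‖u p‖ ^ 2 ≤ (u p).im ^ 2 with hPdef
    set goodN : Finset ℕ := (Ico p₁ (p₁ + n)).filter P with hgoodN
    set good : Finset (Fin r) := univ.filter (fun j : Fin r ↦ j.val + 1 ∈ goodN) with hgood
    -- parity: `n ≤ 2 #goodN + 1`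
    have hparity : n ≤ 2 * goodN.card + 1 := by
      refine card_le_two_mul_card_filter_add_one P n p₁ (fun p _ _ ↦ ?_)
      have := im_sq_or_im_div_sq hzC hzre (u p)
      rwa [hu_succ] at this
    -- `#good = #goodN`
    have hmemN : ∀ p ∈ goodN, p₁ ≤ p ∧ p ≤ p₂ := by
      intro p hp
      rw [hgoodN, mem_filter, mem_Ico] at hp
      constructor
      · exact hp.1.1
      · have := hp.1.2; rw [hndef] at this; omega
    have hcard : good.card = goodN.card := by
      refine Finset.card_bij (fun (j : Fin r) _ ↦ j.val + 1) (fun j hj ↦ ?_) (fun j₁ hj₁ j₂ hj₂ h ↦ ?_)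
        (fun p hp ↦ ?_)
      · rw [hgood, mem_filter] at hj; exact hj.2
      · exact Fin.ext (by omega)
      · obtain ⟨hq1, hq2⟩ := hmemN p hp
        have hp1' : 1 ≤ p := le_trans hp₁1 hq1
        refine ⟨⟨p - 1, by omega⟩, ?_, by dsimp only; omega⟩
        rw [hgood, mem_filter]
        refine ⟨mem_univ _, ?_⟩
        dsimp only
        rwa [Nat.sub_add_cancel hp1']
    have hgood_card1 : (1 : ℝ) ≤ good.card := by
      rw [hcard]
      have : 1 ≤ goodN.card := by omega
      exact_mod_cast this
    have hgood_card : ((n : ℝ) - 1) / 2 ≤ good.card := by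
      rw [hcard]
      have : (n : ℝ) ≤ 2 * goodN.card + 1 := by exact_mod_cast hparity
      linarith
    -- the saving on `good`
    have hgood_bound : ∀ j ∈ good,
        Real.log (∑ μ ∈ Icc (-((k : ℤ) * (a₀ : ℤ) ^ (j.val + 1))) ((k : ℤ) * (a₀ : ℤ) ^ (j.val + 1)),
          geomBound (2 * k * (a₀ : ℝ) ^ (j.val + 1) + 1) (α j * μ)) ≤
          2 * Real.log (2 * k * (a₀ : ℝ) ^ (j.val + 1) + 1) - 0.15 * Y * ℓ := by
      intro j hj
      rw [hgood, mem_filter] at hj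
      have hjN := hj.2
      obtain ⟨hq1, hq2⟩ := hmemN _ hjN
      rw [hgoodN, mem_filter] at hjN
      have hPj : 9 / 100 * ‖u (j.val + 1)‖ ^ 2 ≤ (u (j.val + 1)).im ^ 2 := hjN.2
      set p : ℕ := j.val + 1 with hpdef
      have hp1 : 1 ≤ p := by omega
      have hp0 : (0 : ℝ) < p := by exact_mod_cast (by omega : 0 < p)
      have hpY : Y + 0.06 ≤ 0.52 * p := by
        have h1 : (p₁ : ℝ) ≤ p := by exact_mod_cast hq1
        have h2 : (Y + 0.06) / 0.52 ≤ p := hp₁ge.trans h1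
        rwa [div_le_iff₀ (by norm_num), mul_comm] at h2
      have hp20 : (p : ℝ) ≤ 20 * Y := le_trans (by exact_mod_cast hq2) hp₂le
      -- the two-sided size of `α j`
      have hIm_le : |(u p).im| ≤ ‖u p‖ := Complex.abs_im_le_norm _
      have hIm_ge : 3 / 10 * ‖u p‖ ≤ |(u p).im| := by
        have h0 : 0 ≤ 3 / 10 * ‖u p‖ := by positivity
        rw [← sq_le_sq₀ h0 (abs_nonneg _), sq_abs]
        nlinarith only [hPj]
      have hzp_lo : Real.exp (p * ℓ) ≤ ‖(z : ℂ)‖ ^ p := by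
        calc Real.exp (p * ℓ) = (Real.exp ℓ) ^ p := by rw [← Real.exp_nat_mul]
          _ = B ^ p := by rw [hBexp]
          _ ≤ ‖(z : ℂ)‖ ^ p := pow_le_pow_left₀ hB0.le hzB p
      have hzp_hi : ‖(z : ℂ)‖ ^ p ≤ 2 ^ p * Real.exp (p * ℓ) := by
        calc ‖(z : ℂ)‖ ^ p ≤ (2 * B) ^ p := pow_le_pow_left₀ (norm_nonneg _) hz2B p
          _ = 2 ^ p * Real.exp (p * ℓ) := by rw [mul_pow, hBexp, ← Real.exp_nat_mul]
      have hzp0 : 0 < ‖(z : ℂ)‖ ^ p := pow_pos hzpos p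
      have hαhi : |α j| ≤ τ / (2 * π * p * Real.exp (p * ℓ)) := by
        rw [hα_abs j, ← hpdef, div_le_div_iff₀ (by positivity) (by positivity)]
        have h1 : |(u p).im| ≤ τ / ‖(z : ℂ)‖ ^ p := by rw [← hu_norm]; exact hIm_le
        have h2 : τ / ‖(z : ℂ)‖ ^ p ≤ τ / Real.exp (p * ℓ) := div_le_div_of_nonneg_left hτ0.le (Real.exp_pos _) hzp_lo
        have h3 : |(u p).im| * Real.exp (p * ℓ) ≤ τ := by
          have := (h1.trans h2)
          rwa [le_div_iff₀ (Real.exp_pos _)] at this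
        have hp' : (((j.val : ℕ) : ℝ) + 1) = (p : ℝ) := by rw [hpdef]; push_cast; ring
        rw [hp']
        have h4 := mul_le_mul_of_nonneg_left h3 (by positivity : (0 : ℝ) ≤ 2 * π * p)
        linarith only [h4]
      have hαlo : 3 / 10 * (τ / (2 * π * p * (2 ^ p * Real.exp (p * ℓ)))) ≤ |α j| := by
        rw [hα_abs j, ← hpdef]
        have hp' : (((j.val : ℕ) : ℝ) + 1) = (p : ℝ) := by rw [hpdef]; push_cast; ring
        rw [hp', le_div_iff₀ (by positivity)]
        have h1 : 3 / 10 * (τ / ‖(z : ℂ)‖ ^ p) ≤ |(u p).im| := by rw [← hu_norm]; exact hIm_ge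
        have h2 : τ / (2 ^ p * Real.exp (p * ℓ)) ≤ τ / ‖(z : ℂ)‖ ^ p := div_le_div_of_nonneg_left hτ0.le hzp0 hzp_hi
        calc 3 / 10 * (τ / (2 * π * p * (2 ^ p * Real.exp (p * ℓ)))) * (2 * π * p)
            = 3 / 10 * (τ / (2 ^ p * Real.exp (p * ℓ))) := by field_simp
          _ ≤ 3 / 10 * (τ / ‖(z : ℂ)‖ ^ p) := by gcongr
          _ ≤ |(u p).im| := h1
      exact log_geomSum_le_of_coeff_bounds (by linarith) (by nlinarith) hY hτ hτ0 hp1 hpY hp20 ha_half hax hk1 h3k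
        hαlo hαhi
    -- Korobov's bound with this good set
    have hK := KorobovU.norm_U_le_of_good α hr2 ha₀1 hρ1 hk_eq good hgood_bound
    refine hK.trans (mul_le_mul_of_nonneg_left ?_ (by positivity))
    rw [Real.exp_le_exp, neg_le_neg_iff]
    -- ### the budget: `ℓ/(10¹² M) ≤ (#good · 0.15Yℓ − T)/(4k²)`
    have h4k : 4 * (k : ℝ) ^ 2 = 484 * (r : ℝ) ^ 4 := by rw [hkr]; ring
    have hδ : (1 - 1 / (r : ℝ)) ^ ρ ≤ 1 / 20000 := by
      rw [hρdef]
      exact (one_sub_inv_pow_mul_le 10 hr1).trans (by simpa using exp_neg_ten_le)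
    have hδ0 : 0 ≤ (1 - 1 / (r : ℝ)) ^ ρ := by
      apply pow_nonneg; rw [sub_nonneg, div_le_one hr0]; exact_mod_cast hr1
    have hloga₀0 : 0 ≤ Real.log a₀ := Real.log_nonneg ha₀1r
    -- (T1)
    have hT1 : 2 * (((r : ℝ) ^ 2 + r) / 2) * (1 - 1 / (r : ℝ)) ^ ρ * Real.log a₀ ≤
        ((r : ℝ) ^ 2 + r) * ℓ / 40000 := by
      calc 2 * (((r : ℝ) ^ 2 + r) / 2) * (1 - 1 / (r : ℝ)) ^ ρ * Real.log a₀
          ≤ 2 * (((r : ℝ) ^ 2 + r) / 2) * (1 / 20000) * (0.48 * ℓ) := by gcongr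
        _ ≤ ((r : ℝ) ^ 2 + r) * ℓ / 40000 := by
            have : 0 ≤ ((r : ℝ) ^ 2 + r) * ℓ := by positivity
            linarith only [this]
    -- (T2) `6kρ log(32r) ≤ 660 r³ · 32 r`
    have hT2 : 6 * (k : ℝ) * ρ * Real.log (32 * r) ≤ 21120 * (r : ℝ) ^ 4 := by
      rw [hkr, hρr]
      have h1 : Real.log (32 * r) ≤ 32 * r := by
        have := Real.log_le_sub_one_of_pos (show (0 : ℝ) < 32 * r by positivity); linarith
      have h0 : 0 ≤ 6 * (11 * (r : ℝ) ^ 2) * (10 * r) := by positivity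
      calc 6 * (11 * (r : ℝ) ^ 2) * (10 * r) * Real.log (32 * r) ≤ 6 * (11 * (r : ℝ) ^ 2) * (10 * r) * (32 * r) :=
            mul_le_mul_of_nonneg_left h1 h0
        _ = 21120 * (r : ℝ) ^ 4 := by ring
    -- (T3) `2r log(3k) ≤ 2r ℓ/100`?? too weak; use `log(3k) ≤ 2 log ℓ ≤ 2·10⁻⁵ ℓ`
    have hT3 : 2 * (r : ℝ) * Real.log (3 * k) ≤ 4e-5 * r * ℓ := by
      have h1 : 3 * (k : ℝ) ≤ ℓ ^ 2 := by
        rw [hkr]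
        have : 33 * (r : ℝ) ^ 2 ≤ 33 * ℓ := by linarith only [hrℓ]
        have h' : 33 * ℓ ≤ ℓ ^ 2 := by nlinarith only [c1]
        linarith only [this, h']
      have h2 : Real.log (3 * k) ≤ 2 * Real.log ℓ := by
        have := Real.log_le_log (by positivity : (0 : ℝ) < 3 * k) h1
        rwa [Real.log_pow, Nat.cast_ofNat] at this
      have h3 : Real.log (3 * k) ≤ 2e-5 * ℓ := by linarith only [h2, c2]
      have := mul_le_mul_of_nonneg_left h3 (by positivity : (0 : ℝ) ≤ 2 * r)
      linarith only [this]
    rw [div_le_div_iff₀ (by positivity) (by positivity), h4k]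
    have hYℓ12 : 0.12 * ℓ ≤ Y * ℓ := mul_le_mul_of_nonneg_right hY hℓ0.le
    -- two cases according to `Y ≤ 1` or `Y ≥ 1`
    rcases le_or_gt Y 1 with hY1 | hY1
    · -- small `Y`: one good index suffices; `r ≤ 27`
      have hM : M = 1 := by rw [hMdef]; exact max_eq_left (by nlinarith only [hY1, hY0])
      have hr27' : (r : ℝ) ≤ 27 := by linarith only [hr_le, hY1]
      have hr4 : (r : ℝ) ^ 4 ≤ 531441 := by
        calc (r : ℝ) ^ 4 ≤ 27 ^ 4 := pow_le_pow_left₀ hr0.le hr27' 4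
          _ = 531441 := by norm_num
      have hrr : (r : ℝ) ^ 2 + r ≤ 820 * Y := by
        have h1 : (r : ℝ) * r ≤ (25 * Y + 2) * (25 * Y + 2) :=
          mul_le_mul hr_le hr_le hr0.le (by linarith only [hY0])
        have h2 : 0 ≤ (1 - Y) * Y := mul_nonneg (by linarith only [hY1]) hY0.le
        nlinarith only [h1, h2, hY, hr_le, hY1]
      have hsav : 0.15 * Y * ℓ ≤ good.card * (0.15 * Y * ℓ) := by
        have h0 : 0 ≤ 0.15 * Y * ℓ := by positivity
        nlinarith only [hgood_card1, h0]
      have eT1 : 2 * (((r : ℝ) ^ 2 + r) / 2) * (1 - 1 / (r : ℝ)) ^ ρ * Real.log a₀ ≤ 0.021 * (Y * ℓ) := by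
        refine hT1.trans ?_
        have := mul_le_mul_of_nonneg_right hrr hℓ0.le
        rw [div_le_iff₀ (by norm_num)]
        linarith only [this, hYℓ0]
      have eT2 : 6 * (k : ℝ) * ρ * Real.log (32 * r) ≤ 1.13e10 := hT2.trans (by linarith only [hr4])
      have eT3 : 2 * (r : ℝ) * Real.log (3 * k) ≤ 1.1e-3 * ℓ := by
        refine hT3.trans ?_
        have := mul_le_mul_of_nonneg_right hr27' hℓ0.le
        linarith only [this, hℓ0]
      have eL : ℓ * (484 * (r : ℝ) ^ 4) ≤ 2.58e8 * ℓ := by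
        have := mul_le_mul_of_nonneg_left hr4 hℓ0.le
        linarith only [this, hℓ0]
      rw [hM]
      linarith only [hsav, eT1, eT2, eT3, eL, hYℓ12, c1]
    · -- large `Y`: `#good ≥ 7.9 Y`
      have hM : M = Y ^ 2 := by rw [hMdef]; exact max_eq_right (by nlinarith only [hY1])
      have hgc : 7.9 * Y ≤ good.card := by linarith only [hgood_card, hn_ge, hY1]
      have hsav : 7.9 * Y * (0.15 * Y * ℓ) ≤ good.card * (0.15 * Y * ℓ) := by
        have h0 : 0 ≤ 0.15 * Y * ℓ := by positivity
        nlinarith only [hgc, h0]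
      have hr27Y : (r : ℝ) ≤ 27 * Y := by linarith only [hr_le, hY1]
      have hr4 : (r : ℝ) ^ 4 ≤ 531441 * Y ^ 4 := by
        calc (r : ℝ) ^ 4 ≤ (27 * Y) ^ 4 := pow_le_pow_left₀ hr0.le hr27Y 4
          _ = 531441 * Y ^ 4 := by ring
      have hrr : (r : ℝ) ^ 2 + r ≤ 756 * Y ^ 2 := by
        have h1 : (r : ℝ) ^ 2 ≤ (27 * Y) ^ 2 := pow_le_pow_left₀ hr0.le hr27Y 2
        have h2 : 0 ≤ (Y - 1) * Y := mul_nonneg (by linarith only [hY1]) hY0.le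
        nlinarith only [h1, h2, hr27Y]
      have hY2ℓ : 0 ≤ Y ^ 2 * ℓ := by positivity
      have hY4 : Y ^ 4 ≤ 1e-12 * (Y ^ 2 * ℓ) := by
        have := mul_le_mul_of_nonneg_left hYsq (sq_nonneg Y)
        nlinarith only [this]
      have eT1 : 2 * (((r : ℝ) ^ 2 + r) / 2) * (1 - 1 / (r : ℝ)) ^ ρ * Real.log a₀ ≤ 0.0189 * (Y ^ 2 * ℓ) := by
        refine hT1.trans ?_
        have := mul_le_mul_of_nonneg_right hrr hℓ0.le
        rw [div_le_iff₀ (by norm_num)]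
        linarith only [this, hY2ℓ]
      have eT2 : 6 * (k : ℝ) * ρ * Real.log (32 * r) ≤ 0.0113 * (Y ^ 2 * ℓ) := by
        refine hT2.trans ?_
        linarith only [hr4, hY4, hY2ℓ]
      have eT3 : 2 * (r : ℝ) * Real.log (3 * k) ≤ 1.1e-3 * (Y ^ 2 * ℓ) := by
        refine hT3.trans ?_
        have h1 := mul_le_mul_of_nonneg_right hr27Y hℓ0.le
        have hYY : Y ≤ Y ^ 2 := by nlinarith only [hY1]
        have h2 : Y * ℓ ≤ Y ^ 2 * ℓ := mul_le_mul_of_nonneg_right hYY hℓ0.le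
        linarith only [h1, h2, hY2ℓ]
      have hS : 1.1 * (Y ^ 2 * ℓ) ≤ good.card * (0.15 * Y * ℓ) -
          (2 * (((r : ℝ) ^ 2 + r) / 2) * (1 - 1 / (r : ℝ)) ^ ρ * Real.log a₀ +
            6 * k * ρ * Real.log (32 * r) + 2 * r * Real.log (3 * k)) := by
        have : 7.9 * Y * (0.15 * Y * ℓ) = 1.185 * (Y ^ 2 * ℓ) := by ring
        linarith only [hsav, eT1, eT2, eT3, this, hY2ℓ]
      have hY4ℓ : 0 ≤ Y ^ 2 * ℓ * Y ^ 2 := by positivity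
      have eL : ℓ * (484 * (r : ℝ) ^ 4) ≤ 2.58e8 * (Y ^ 2 * ℓ * Y ^ 2) := by
        have := mul_le_mul_of_nonneg_left hr4 hℓ0.le
        linarith only [this, hY4ℓ]
      have h2 := mul_le_mul_of_nonneg_right hS (by positivity : (0 : ℝ) ≤ 1e12 * Y ^ 2)
      rw [hM]
      linarith only [eL, h2, hY4ℓ]
  -- ### summing over `a`
  have hmain : 1 / (a₀ : ℝ) ^ 2 * ∑ a ∈ Icc A₁ A₂,
      ‖∑ x ∈ Icc (1 : ℤ) a₀, ∑ y ∈ Icc (1 : ℤ) a₀,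
        e (∑ j : Fin r, ((-1) ^ (j.val) * ((w * ((((⟨a, b⟩ : GaussianInt) : ℂ))⁻¹) ^ (j.val + 1)).im) /
          (2 * π * (j.val + 1))) * ((x : ℝ) ^ (j.val + 1) * (y : ℝ) ^ (j.val + 1)))‖ ≤
      3 * B * Real.exp (-(ℓ / (1e12 * M))) := by
    calc 1 / (a₀ : ℝ) ^ 2 * ∑ a ∈ Icc A₁ A₂, _ ≤ 1 / (a₀ : ℝ) ^ 2 * ∑ _a ∈ Icc A₁ A₂,
          (a₀ : ℝ) ^ 2 * Real.exp (-(ℓ / (1e12 * M))) := by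
          gcongr with a ha
          exact hU a ha
      _ = (Icc A₁ A₂).card * Real.exp (-(ℓ / (1e12 * M))) := by
          rw [sum_const, nsmul_eq_mul]
          rw [show (1 : ℝ) / (a₀ : ℝ) ^ 2 * (((Icc A₁ A₂).card : ℝ) * ((a₀ : ℝ) ^ 2 * Real.exp (-(ℓ / (1e12 * M)))))
              = ((Icc A₁ A₂).card : ℝ) * Real.exp (-(ℓ / (1e12 * M))) * ((a₀ : ℝ) ^ 2 / (a₀ : ℝ) ^ 2) by ring,
            div_self (by positivity), mul_one]
      _ ≤ 3 * B * Real.exp (-(ℓ / (1e12 * M))) := by gcongr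
  -- ### conclusion
  have hcmp : Real.exp (-(0.04 * ℓ)) ≤ Real.exp (-(ℓ / (1e12 * M))) := by
    rw [Real.exp_le_exp, neg_le_neg_iff, div_le_iff₀ (by positivity)]
    have := mul_le_mul_of_nonneg_right hM1 hℓ0.le
    nlinarith only [this, hℓ0]
  calc ‖∑ a ∈ Icc A₁ A₂, F a‖ ≤ _ := hshift
    _ ≤ 3 * B * Real.exp (-(ℓ / (1e12 * M))) + 6 * B * Real.exp (-(0.04 * ℓ)) + 2 * B * Real.exp (-(0.04 * ℓ)) :=
        add_le_add (add_le_add hmain herr1) herr2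
    _ ≤ 3 * B * Real.exp (-(ℓ / (1e12 * M))) + 6 * B * Real.exp (-(ℓ / (1e12 * M))) +
          2 * B * Real.exp (-(ℓ / (1e12 * M))) := by gcongr
    _ = 11 * B * Real.exp (-(ℓ / (1e12 * M))) := by ring

end GaussLine

end Literature.NumberTheory.LFunctions
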